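import Summits.QuantumFields.YangMills.Theorems.FluctuationComparisonRegPrIntLS2BetaRelativeFieldLetterTwoTowerL2
import Summits.QuantumFields.YangMills.Theorems.FluctuationComparisonRegPrIntLS2BetaBackgroundTowerLetter
import Summits.QuantumFields.YangMills.Theorems.FluctuationComparisonRegPrIntLS2BetaRelativeTowerSupBudget128
import Summits.QuantumFields.YangMills.Theorems.FluctuationComparisonRegPrIntLS2BetaWhitneyHatLift
import Summits.QuantumFields.YangMills.Theorems.FluctuationComparisonRegPrIntLS2BetaGeodesicJensenLift
import Literature.MathematicalPhysics.QuantumFieldTheory.Balaban1983to89.B16Ineq17NearFlatWilsonLettersLocal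
import HarnessLib

/-!
# S2β · the (D-stage) REL-TEL road — `FLAPREL(G)` FROM px21 g23's TWO-TOWER FLAP LETTER C4 (✓p825893) WITH THE BACKGROUND TOWER AS «TOWER 1»:
# the second displayed letter of the prefix assembly ⧗`…StageFeedersAssembly.feedbackLetterPrefix_of_letters`, from the BKG-TOWER letter (✓p825096's output shape)

Cell `ym3-torus` (rung R3 = continuum `SU(2)` Yang–Mills on T³ — NOT d = 4, NOT infinite volume, NOT a mass gap, NOT Clay).  Width seat «width 12» `ym3-torus-px12`
(gen 24), FREE px helper on crux `stmt-QuantumFields-20520`; `--kind proof --supports … --as helper`, count-neutral, DEFINITION-FREE (0 `def`∕`instance`∕`notation`∕`sorry`).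

WHAT.  ★★★`flapLetter_of_C4 (Gx) (hGx : Gx ⟹ arc ≤ 1∕128) (hBkgT : BKGTOWER Gx) : FLAPREL Gx` — at every level `j < K−J` of the two stage towers, C4
✓`sqrt_sum_dist1_flap_rel_sq_le` at `(W, U; W₀, U₀) := (U′₀_j, V₀_j; U′_j, V_j)` (tower 1 = the BACKGROUND tower carries every size: `θW := C₁θ_J·L^{2j}(L⁻¹)^{2N}`
from `BKGTOWER`, `θU := 4L⁻¹·s̃_{j+1}` = the BKG lift's plaquettes by its sup profile (✓`exists_gamma_supBudget_128`, ✓`arc_lift_le`, lit ✓`dist1_plaqHol_le_of_bonds`,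
✓`dist1_le_norm_logVec`), `θW₀ := θBal(K−j)` from `histGood`; (T4)∕(T5) + ✓`axialAvg_lift` give `hax`, `havg`), read in the DOOR's right-relative currency
(lit ✓`dist1_inv_mul_eq`, `dist1_inv`): `flap_j ≤ a₁A_j + a₂A^V_j + η_jB_j + ζ_jB^V_j` with `a₁ = G₀R_a + √(L²)·3G₀R_c`, `a₂ = G₀R_a`, `η_j ∝ θW_j` (so `Σ_jη_j ≤ δ`
for `γ ≤ γ₁(δ)`, lit ✓`exists_gamma_forall_θBal_le`), `ζ_j ∝ θU_j, θW_j` (`Σ_jζ_j ≤ Z`, the BKG profile's ℓ¹ budget).  `BKGTOWER(G)` is ✓`bkgTower_of_bkgLetter`'s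
conclusion shape (px5's (BKG) ⟹ it; OUTRIGHT at `L ≥ 5`).
HONEST SCOPE.  Instantiation and prefix plumbing by name; nothing of Bałaban's analysis is asserted; `KEYREL`, (D-ax)∕(D♮), (F♮), GAP♯∘ (`stub_uniformFibreGapOrbit`), S2β,
the five registered stubs (0∕5), crux 20520 and `YM3TorusSU2` are NOT proved; no registered stub is closed; the Yang–Mills mass gap is NOT proved.
References: T. Bałaban, CMP **99** (1985) 75–102 [Balaban1985RegularSpaces] (Lemma 1 (1.24)–(1.26) pp.79–80, (1.29) p.81); CMP **98** (1985) 17–51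
[Balaban1985Averaging] ((19)–(21) pp.21–22); CMP **102** (1985) 277–309 [Balaban1985Variational] ((4) p.278).
-/

set_option autoImplicit false

noncomputable section

namespace Summit.QuantumFields.YangMills.Theorems.FluctuationComparisonRegPrIntLS2BetaStageFlapLetterOfC4

open Finset
open scoped Real
open Literature.MathematicalPhysics.QuantumLattice (su2Quat)
open Literature.MathematicalPhysics.QuantumFieldTheory.Balaban1983to89
open T4Continuum T3ContinuumYM3Torus T3UnitScaleTilt T3TiltDescent T3LevelShift BlockAveraging
open T4CubeChartGnomonic (SU2)
open T4HaarSU2ExpChart (expPoint)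
open T4ExpWindowSmallField (logVec)
open T3UnitLawDensityEML (ℰp)
open T3ConstrainedMinimiser (fibre)
open T3PrintedRegularMinimiser (minActionRegPr)
open B10Eq27TorusAxialLog (rel axialT)
open T3Thresholds (exists_gamma_forall_θBal_le)
open T3MinimiserStabilityReduction (θBal_pos)
open B11GaugeGlue (dist1_inv_mul_eq)
open B16Ineq17NearFlatWilsonLettersLocal (dist1_plaqHol_le_of_bonds)
open ExpMeanLog (deltaSU deltaSU_pos expMeanLogSU)
open Summit.QuantumFields.YangMills.Theorems.FluctuationComparisonRegPrIntLS2BetaRelativeFieldLetterTwoTowerL2 (sqrt_sum_dist1_flap_rel_sq_le')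
open Summit.QuantumFields.YangMills.Theorems.FluctuationComparisonRegPrIntLS2BetaRelativeTowerSupBudget128 (exists_gamma_supBudget_128)
open Summit.QuantumFields.YangMills.Theorems.FluctuationComparisonRegPrIntLS2BetaWhitneyHatLift (arc_lift_le axialAvg_lift)
open Summit.QuantumFields.YangMills.Theorems.FluctuationComparisonRegPrIntLS2BetaGeodesicJensenLift (dist1_le_norm_logVec)

variable {P : Params} {j : ℕ}

/-- Right-relative versus left-relative `dist1` of a pair. [folklore] -/
theorem dist1_inv_mul_comm' (a b : SU2) : dist1 (a⁻¹ * b) = dist1 (b * a⁻¹) := by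
  rw [dist1_inv_mul_eq, ← GaugeGroup.dist1_inv (a * b⁻¹), mul_inv_rev, inv_inv]

/-- The BACKGROUND weights sum to at most one: `Σ_{j<N} L^{2j}·(L⁻¹)^{2N} ≤ 1` (`L ≥ 2`). [cite: Balaban1985Variational, (4) p.278] -/
theorem geo_weight_sum_le_one {L : ℝ} (hL : 2 ≤ L) (N : ℕ) : ∑ j ∈ range N, L ^ (2 * j) * (L⁻¹) ^ (2 * N) ≤ 1 := by
  have hL0 : 0 < L := by linarith
  have hL2 : (1 : ℝ) < L ^ 2 := by nlinarith
  have hsum : ∑ j ∈ range N, (L ^ 2) ^ j ≤ (L ^ 2) ^ N / (L ^ 2 - 1) := by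
    rw [geom_sum_eq hL2.ne' N]
    exact div_le_div_of_nonneg_right (by linarith) (by linarith)
  have hLN : (L⁻¹) ^ (2 * N) * (L ^ 2) ^ N = 1 := by
    rw [← pow_mul, inv_pow, inv_mul_cancel₀ (pow_ne_zero _ hL0.ne')]
  calc ∑ j ∈ range N, L ^ (2 * j) * (L⁻¹) ^ (2 * N) = (L⁻¹) ^ (2 * N) * ∑ j ∈ range N, (L ^ 2) ^ j := by
        rw [Finset.mul_sum]; exact Finset.sum_congr rfl fun j _ => by rw [← pow_mul]; ring
    _ ≤ (L⁻¹) ^ (2 * N) * ((L ^ 2) ^ N / (L ^ 2 - 1)) := mul_le_mul_of_nonneg_left hsum (by positivity)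
    _ = 1 / (L ^ 2 - 1) := by rw [← mul_div_assoc, hLN]
    _ ≤ 1 := by rw [div_le_one (by linarith)]; nlinarith

/-- Guard row: `G₀·θ ≤ ¼` from `θ ≤ C₁σ`, `σ ≤ 1∕(4(G₀C₁+1))`. [folklore] -/
theorem guard_quarter {G₀ C₁ σ θ : ℝ} (hG₀ : 0 < G₀) (hC₁ : 0 ≤ C₁) (hθ : θ ≤ C₁ * σ) (hσ : σ ≤ 1 / (4 * (G₀ * C₁ + 1))) :
    G₀ * θ ≤ 1 / 4 := by
  have h1 : G₀ * θ ≤ G₀ * C₁ * (1 / (4 * (G₀ * C₁ + 1))) := by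
    rw [mul_assoc]; exact mul_le_mul_of_nonneg_left (hθ.trans (mul_le_mul_of_nonneg_left hσ hC₁)) hG₀.le
  have h2 : G₀ * C₁ * (1 / (4 * (G₀ * C₁ + 1))) ≤ 1 / 4 := by
    rw [mul_one_div, div_le_div_iff₀ (by positivity) (by norm_num)]; nlinarith [mul_nonneg hG₀.le hC₁]
  linarith

/-- Guard row: `G₀·θ < Δ` from `θ ≤ C₁σ`, `σ ≤ Δ∕(2(G₀C₁+G₀+1))`. [folklore] -/
theorem guard_lt {G₀ C₁ σ θ Δ : ℝ} (hG₀ : 0 < G₀) (hC₁ : 0 ≤ C₁) (hΔ : 0 < Δ) (hθ : θ ≤ C₁ * σ) (hσ : σ ≤ Δ / (2 * (G₀ * C₁ + G₀ + 1))) :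
    G₀ * θ < Δ := by
  have h1 : G₀ * θ ≤ G₀ * C₁ * (Δ / (2 * (G₀ * C₁ + G₀ + 1))) := by
    rw [mul_assoc]; exact mul_le_mul_of_nonneg_left (hθ.trans (mul_le_mul_of_nonneg_left hσ hC₁)) hG₀.le
  have h2 : G₀ * C₁ * (Δ / (2 * (G₀ * C₁ + G₀ + 1))) < Δ := by
    rw [← mul_div_assoc, div_lt_iff₀ (by positivity)]; nlinarith [mul_nonneg hG₀.le hC₁]
  linarith

/-- Guard row: `G₀·θ < Δ` from `θ ≤ σ`, `σ ≤ Δ∕(2(G₀C₁+G₀+1))`. [folklore] -/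
theorem guard_lt' {G₀ C₁ σ θ Δ : ℝ} (hG₀ : 0 < G₀) (hC₁ : 0 ≤ C₁) (hΔ : 0 < Δ) (hθ : θ ≤ σ) (hσ : σ ≤ Δ / (2 * (G₀ * C₁ + G₀ + 1))) :
    G₀ * θ < Δ := by
  have h1 : G₀ * θ ≤ G₀ * (Δ / (2 * (G₀ * C₁ + G₀ + 1))) := mul_le_mul_of_nonneg_left (hθ.trans hσ) hG₀.le
  have h2 : G₀ * (Δ / (2 * (G₀ * C₁ + G₀ + 1))) < Δ := by
    rw [← mul_div_assoc, div_lt_iff₀ (by positivity)]; nlinarith [mul_nonneg hG₀.le hC₁]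
  linarith

/-- Budget row: `cη·C₁·θ·S ≤ δ` from `θ ≤ σ ≤ δ∕(cηC₁+1)`, `S ≤ 1`. [folklore] -/
theorem eta_budget_le {cη C₁ σ θ δ S : ℝ} (hcη : 0 ≤ cη) (hC₁ : 0 ≤ C₁) (hθ0 : 0 ≤ θ) (hθ : θ ≤ σ)
    (hσδ : σ ≤ δ / (cη * C₁ + 1)) (hS : S ≤ 1) : cη * C₁ * θ * S ≤ δ := by
  have h1 : cη * C₁ * θ * S ≤ cη * C₁ * σ := by
    calc cη * C₁ * θ * S ≤ cη * C₁ * θ * 1 := mul_le_mul_of_nonneg_left hS (by positivity)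
      _ ≤ cη * C₁ * σ := by rw [mul_one]; exact mul_le_mul_of_nonneg_left hθ (by positivity)
  have h2 : σ * (cη * C₁ + 1) ≤ δ := (le_div_iff₀ (by positivity)).1 hσδ
  nlinarith

set_option maxHeartbeats 400000 in
/-- ★★★ **`FLAPREL(G)` FROM C4 WITH THE BACKGROUND TOWER AS «TOWER 1»**. [cite: Balaban1985RegularSpaces, Lemma 1 p.79, (1.29) p.81; Balaban1985Averaging, (19)-(21) pp.21-22] -/
theorem flapLetter_of_C4
    (Gx : (F : T3Family) → (J : ℕ) → GaugeField (F.P J) 0 (Matrix.specialUnitaryGroup (Fin 2) ℂ) → Prop)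
    (hGx : ∀ (F : T3Family) (J : ℕ) (V : GaugeField (F.P J) 0 (Matrix.specialUnitaryGroup (Fin 2) ℂ)), Gx F J V →
      ∀ e, ‖logVec (su2Quat (V e))‖ ≤ 1 / 128)
    (hBkgT : ∀ (L : ℕ), ∃ c₀ : ℝ, 0 < c₀ ∧ c₀ ≤ 1 ∧ ∀ (cw : ℝ), 0 < cw → cw ≤ c₀ → ∃ pS : ℝ, ∀ (b₀ p₀ : ℝ), 0 < b₀ → pS ≤ p₀ → 0 < p₀ → ∃ ε₁ : ℝ, 0 < ε₁ ∧ ∀ (ε₀ : ℝ), 0 < ε₀ → ε₀ ≤ ε₁ →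
    ∃ γ₁ : ℝ, 0 < γ₁ ∧ ∃ C₁ : ℝ, 0 ≤ C₁ ∧ ∀ (F : T3Family) (γ : ℝ), F.L = L → 0 < γ → γ ≤ γ₁ →
      ∀ (J K : ℕ) (hJK : J ≤ K) (V : GaugeField (F.P J) 0 (Matrix.specialUnitaryGroup (Fin 2) ℂ)), PlaqSmall (θBal F.L γ (cw * b₀) p₀ J) V →
        Gx F J V →
        ∀ U₀ ∈ {U' : GaugeField (F.P K) 0 (Matrix.specialUnitaryGroup (Fin 2) ℂ) | U' ∈ fibre F ℰp J K hJK V ∧ U' ∈ histGood F ℰp (θBal F.L γ b₀ p₀) K J ∧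
            wilsonAction4 U' = minActionRegPr F J K hJK ε₀ V},
        ∀ t, t ≤ K - J → ∀ p : Plaq (F.P K) t,
          dist1 (GaugeField.plaqHol (Averaging.iter (fun k => blockAvg (P := F.P K) (j := k) ℰp) t U₀) p) ≤
            C₁ * θBal F.L γ b₀ p₀ J * (F.L : ℝ) ^ (2 * t) * ((F.L : ℝ)⁻¹) ^ (2 * (K - J))) :
    ∀ (L : ℕ), ∃ c₀ : ℝ, 0 < c₀ ∧ c₀ ≤ 1 ∧ ∀ (cw : ℝ), 0 < cw → cw ≤ c₀ → ∃ pS : ℝ, ∀ (b₀ p₀ : ℝ), 0 < b₀ → pS ≤ p₀ → 0 < p₀ → ∃ ε₁ : ℝ, 0 < ε₁ ∧ ∀ (ε₀ : ℝ), 0 < ε₀ → ε₀ ≤ ε₁ →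
      ∃ a₁ a₂ Z : ℝ, 0 < a₁ ∧ 0 ≤ a₂ ∧ 0 ≤ Z ∧ ∀ (δ : ℝ), 0 < δ → ∃ γ₁ : ℝ, 0 < γ₁ ∧ ∀ (F : T3Family) (γ : ℝ), F.L = L → 0 < γ → γ ≤ γ₁ →
        ∀ (J K : ℕ) (hJK : J ≤ K) (V : GaugeField (F.P J) 0 (Matrix.specialUnitaryGroup (Fin 2) ℂ)), PlaqSmall (θBal F.L γ (cw * b₀) p₀ J) V →
          Gx F J V →
          ∀ U₀ ∈ {U' : GaugeField (F.P K) 0 (Matrix.specialUnitaryGroup (Fin 2) ℂ) | U' ∈ fibre F ℰp J K hJK V ∧ U' ∈ histGood F ℰp (θBal F.L γ b₀ p₀) K J ∧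
              wilsonAction4 U' = minActionRegPr F J K hJK ε₀ V},
          ∀ U ∈ fibre F ℰp J K hJK V, U ∈ histGood F ℰp (θBal F.L γ b₀ p₀) K J →
          ∀ (wt : (j : ℕ) → PBond (F.P K) j → PBond (F.P K) (j + 1) → ℝ)
            (lift : (j : ℕ) → GaugeField (F.P K) (j + 1) SU2 → GaugeField (F.P K) j SU2),
            (∀ j b e, wt j b e = if e.dir = b.dir ∧ (b.src b.dir - emb e.src b.dir).val < (F.P K).L then
                ∏ ν ∈ Finset.univ.erase b.dir, max 0 (1 - ((rel (emb e.src) b.src ν).natAbs : ℝ) / (F.P K).L) else 0) →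
            (∀ j X b, lift j X b = expPoint (∑ e, wt j b e • ((((F.P K).L : ℕ) : ℝ)⁻¹ • logVec (su2Quat (X e))))) →
          ∀ g g₀ : (j : ℕ) → Site (F.P K) j → SU2,
            (∀ j, j < K - J → ∀ x, g j x =
              (axialT (lift j (GaugeField.gaugeAct (g (j + 1)) (Averaging.iter (fun k => blockAvg (P := F.P K) (j := k) ℰp) (j + 1) U)))
                  (emb (blockOf x)) x)⁻¹ *
                g (j + 1) (blockOf x) * axialT (Averaging.iter (fun k => blockAvg (P := F.P K) (j := k) ℰp) j U) (emb (blockOf x)) x) →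
            (∀ j, K - J ≤ j → ∀ y, g j y = 1) →
            (∀ j, j < K - J → ∀ y : Site (F.P K) (j + 1), g j (emb y) = g (j + 1) y) →
            (∀ X : GaugeField (F.P K) 0 SU2, ∀ j, j ≤ K - J →
              Averaging.iter (fun k => blockAvg (P := F.P K) (j := k) ℰp) j (GaugeField.gaugeAct (g 0) X) =
                GaugeField.gaugeAct (g j) (Averaging.iter (fun k => blockAvg (P := F.P K) (j := k) ℰp) j X)) →
            (∀ j, j < K - J → ∀ x,
              axialT (GaugeField.gaugeAct (g j) (Averaging.iter (fun k => blockAvg (P := F.P K) (j := k) ℰp) j U)) (emb (blockOf x)) x =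
                axialT (lift j (GaugeField.gaugeAct (g (j + 1)) (Averaging.iter (fun k => blockAvg (P := F.P K) (j := k) ℰp) (j + 1) U)))
                  (emb (blockOf x)) x) →
            (∀ j, j < K - J →
              (blockAvg (P := F.P K) (j := j) ℰp).avg (GaugeField.gaugeAct (g j) (Averaging.iter (fun k => blockAvg (P := F.P K) (j := k) ℰp) j U)) =
                GaugeField.gaugeAct (g (j + 1)) (Averaging.iter (fun k => blockAvg (P := F.P K) (j := k) ℰp) (j + 1) U)) →
            (∀ j, j < K - J → ∀ x, g₀ j x =
              (axialT (lift j (GaugeField.gaugeAct (g₀ (j + 1)) (Averaging.iter (fun k => blockAvg (P := F.P K) (j := k) ℰp) (j + 1) U₀)))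
                  (emb (blockOf x)) x)⁻¹ *
                g₀ (j + 1) (blockOf x) * axialT (Averaging.iter (fun k => blockAvg (P := F.P K) (j := k) ℰp) j U₀) (emb (blockOf x)) x) →
            (∀ j, K - J ≤ j → ∀ y, g₀ j y = 1) →
            (∀ j, j < K - J → ∀ y : Site (F.P K) (j + 1), g₀ j (emb y) = g₀ (j + 1) y) →
            (∀ X : GaugeField (F.P K) 0 SU2, ∀ j, j ≤ K - J →
              Averaging.iter (fun k => blockAvg (P := F.P K) (j := k) ℰp) j (GaugeField.gaugeAct (g₀ 0) X) =
                GaugeField.gaugeAct (g₀ j) (Averaging.iter (fun k => blockAvg (P := F.P K) (j := k) ℰp) j X)) →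
            (∀ j, j < K - J → ∀ x,
              axialT (GaugeField.gaugeAct (g₀ j) (Averaging.iter (fun k => blockAvg (P := F.P K) (j := k) ℰp) j U₀)) (emb (blockOf x)) x =
                axialT (lift j (GaugeField.gaugeAct (g₀ (j + 1)) (Averaging.iter (fun k => blockAvg (P := F.P K) (j := k) ℰp) (j + 1) U₀)))
                  (emb (blockOf x)) x) →
            (∀ j, j < K - J →
              (blockAvg (P := F.P K) (j := j) ℰp).avg (GaugeField.gaugeAct (g₀ j) (Averaging.iter (fun k => blockAvg (P := F.P K) (j := k) ℰp) j U₀)) =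
                GaugeField.gaugeAct (g₀ (j + 1)) (Averaging.iter (fun k => blockAvg (P := F.P K) (j := k) ℰp) (j + 1) U₀)) →
            ∃ (η ζ : ℕ → ℝ), (∀ j, 0 ≤ η j) ∧ (∀ j, 0 ≤ ζ j) ∧
              (∀ j, j < K - J →
                √(∑ b, dist1 (GaugeField.gaugeAct (g j) (Averaging.iter (fun k => blockAvg (P := F.P K) (j := k) ℰp) j U) b *
                (lift j (GaugeField.gaugeAct (g (j + 1)) (Averaging.iter (fun k => blockAvg (P := F.P K) (j := k) ℰp) (j + 1) U)) b)⁻¹ *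
              (GaugeField.gaugeAct (g₀ j) (Averaging.iter (fun k => blockAvg (P := F.P K) (j := k) ℰp) j U₀) b *
                (lift j (GaugeField.gaugeAct (g₀ (j + 1)) (Averaging.iter (fun k => blockAvg (P := F.P K) (j := k) ℰp) (j + 1) U₀)) b)⁻¹)⁻¹) ^ 2) ≤
                  a₁ * √(∑ q, dist1 ((GaugeField.plaqHol (GaugeField.gaugeAct (g₀ j) (Averaging.iter (fun k => blockAvg (P := F.P K) (j := k) ℰp) j U₀)) q)⁻¹ *
                  GaugeField.plaqHol (GaugeField.gaugeAct (g j) (Averaging.iter (fun k => blockAvg (P := F.P K) (j := k) ℰp) j U)) q) ^ 2) +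
                    a₂ * √(∑ q, dist1 ((GaugeField.plaqHol (lift j (GaugeField.gaugeAct (g₀ (j + 1)) (Averaging.iter (fun k => blockAvg (P := F.P K) (j := k) ℰp) (j + 1) U₀))) q)⁻¹ *
                  GaugeField.plaqHol (lift j (GaugeField.gaugeAct (g (j + 1)) (Averaging.iter (fun k => blockAvg (P := F.P K) (j := k) ℰp) (j + 1) U))) q) ^ 2) +
                    η j * √(∑ b, dist1 (GaugeField.gaugeAct (g j) (Averaging.iter (fun k => blockAvg (P := F.P K) (j := k) ℰp) j U) b *
                  (GaugeField.gaugeAct (g₀ j) (Averaging.iter (fun k => blockAvg (P := F.P K) (j := k) ℰp) j U₀) b)⁻¹) ^ 2) +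
                    ζ j * √(∑ b, dist1 (lift j (GaugeField.gaugeAct (g (j + 1)) (Averaging.iter (fun k => blockAvg (P := F.P K) (j := k) ℰp) (j + 1) U)) b *
                  (lift j (GaugeField.gaugeAct (g₀ (j + 1)) (Averaging.iter (fun k => blockAvg (P := F.P K) (j := k) ℰp) (j + 1) U₀)) b)⁻¹) ^ 2)) ∧
              ∑ j ∈ range (K - J), η j ≤ δ ∧ ∑ j ∈ range (K - J), ζ j ≤ Z := by
  intro L
  obtain ⟨c₀, hc₀, hc₀1, HB⟩ := hBkgT L
  refine ⟨c₀, hc₀, hc₀1, fun cw hcw hcwle => ?_⟩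
  obtain ⟨pS, HB⟩ := HB cw hcw hcwle
  refine ⟨pS, fun b₀ p₀ hb hpS hp => ?_⟩
  obtain ⟨ε₁, hε₁, HB⟩ := HB b₀ p₀ hb hpS hp
  refine ⟨ε₁, hε₁, fun ε₀ hε₀ hε₀le => ?_⟩
  obtain ⟨γB, hγB, C₁₀, hC₁₀, HB⟩ := HB ε₀ hε₀ hε₀le
  obtain ⟨C₁, hC₁d⟩ : ∃ x : ℝ, x = C₁₀ + 1 := ⟨_, rfl⟩
  have hC₁ : 0 ≤ C₁ := by rw [hC₁d]; positivity
  have hC₁lt : C₁₀ < C₁ := by rw [hC₁d]; linarith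
  by_cases hL : 1 < L
  swap
  · exact ⟨1, 0, 0, one_pos, le_rfl, le_rfl, fun δ _ => ⟨1, one_pos, fun F γ hFL => absurd (hFL ▸ F.hL.2) hL⟩⟩
  obtain ⟨Es, hEs0, γs, hγs, HS⟩ := exists_gamma_supBudget_128 L hL b₀ p₀ hb hp
  have hL' : (1 : ℝ) < L := by exact_mod_cast hL
  have hL0 : (0 : ℝ) < L := by linarith
  -- the constants of C4 at `d = 3`, block `L`
  obtain ⟨G₀, hG₀⟩ : ∃ x : ℝ, x = ((((3 + 2) * L : ℕ) : ℝ) ^ 2 / 4) := ⟨_, rfl⟩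
  obtain ⟨M₅, hM₅⟩ : ∃ x : ℝ, x = (((3 + 2) * L : ℕ) : ℝ) := ⟨_, rfl⟩
  obtain ⟨Ra, hRa⟩ : ∃ x : ℝ, x = √(((3 ^ 3 * L ^ 3 * 3 ^ 2 : ℕ) : ℝ) * ((3 ^ 3 * L ^ 3 * 3 : ℕ) : ℝ)) := ⟨_, rfl⟩
  obtain ⟨Rb, hRb⟩ : ∃ x : ℝ, x = √(((3 ^ 3 * L ^ 3 * 3 : ℕ) : ℝ) * ((3 ^ 3 * L ^ 3 * 3 : ℕ) : ℝ)) := ⟨_, rfl⟩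
  obtain ⟨Rc, hRc⟩ : ∃ x : ℝ, x = √(((3 ^ 3 * L ^ 3 * 3 ^ 2 : ℕ) : ℝ) * ((3 ^ 3 * 3 : ℕ) : ℝ)) := ⟨_, rfl⟩
  obtain ⟨Rd, hRd⟩ : ∃ x : ℝ, x = √(((3 ^ 3 * L ^ 3 * 3 : ℕ) : ℝ) * ((3 ^ 3 * 3 : ℕ) : ℝ)) := ⟨_, rfl⟩
  obtain ⟨Ld, hLd⟩ : ∃ x : ℝ, x = √((L ^ (3 - 1) : ℕ) : ℝ) := ⟨_, rfl⟩
  have hG₀0 : 0 < G₀ := by rw [hG₀]; positivity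
  have hM₅0 : 0 ≤ M₅ := by rw [hM₅]; positivity
  have hRa0 : 0 < Ra := by rw [hRa]; positivity
  have hRb0 : 0 ≤ Rb := by rw [hRb]; positivity
  have hRc0 : 0 ≤ Rc := by rw [hRc]; positivity
  have hRd0 : 0 ≤ Rd := by rw [hRd]; positivity
  have hLd0 : 0 ≤ Ld := by rw [hLd]; positivity
  obtain ⟨cη, hcη⟩ : ∃ x : ℝ, x = 2 * G₀ * (M₅ + 2) * Rb + Ld * (3 * (G₀ * (2 * (M₅ + 2)))) * Rd := ⟨_, rfl⟩
  have hcη0 : 0 ≤ cη := by rw [hcη]; positivity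
  obtain ⟨Z, hZ⟩ : ∃ x : ℝ, x = Rb * G₀ * ((4 * M₅ + 4) * (4 * (L : ℝ)⁻¹ * Es + C₁) + 8 * M₅ * C₁) := ⟨_, rfl⟩
  have hZ0 : 0 ≤ Z := by rw [hZ]; positivity
  refine ⟨G₀ * Ra + Ld * (3 * G₀) * Rc, G₀ * Ra, Z, by positivity, by positivity, hZ0, fun δ hδ => ?_⟩
  -- the threshold targets: guards of C4 on the background size, and `Σ η ≤ δ`
  have hδSU := deltaSU_pos (n := Fin 2)
  obtain ⟨σ, hσ⟩ : ∃ x : ℝ, x = min (min 1 (1 / (4 * (G₀ * C₁ + 1)))) (min (deltaSU (Fin 2) / (2 * (G₀ * C₁ + G₀ + 1))) (δ / (cη * C₁ + 1))) := ⟨_, rfl⟩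
  have hσ0 : 0 < σ := by rw [hσ]; exact lt_min (lt_min one_pos (by positivity)) (lt_min (by positivity) (by positivity))
  obtain ⟨γt, hγt, hγt1, hth⟩ := exists_gamma_forall_θBal_le (b₀ := b₀) (p₀ := p₀) hb hp hσ0
  refine ⟨min γB (min γs γt), lt_min hγB (lt_min hγs hγt),
    fun F γ hFL hγ hγle J K hJK V hV hG U₀ hU₀ U hU hUg wt lift hw hlift g g₀ h0 h1 h2 h3 h4 h5 h0' h1' h2' h3' h4' h5' => ?_⟩
  subst hFL
  have hγB' : γ ≤ γB := hγle.trans (min_le_left _ _)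
  have hγs' : γ ≤ γs := hγle.trans ((min_le_right _ _).trans (min_le_left _ _))
  have hγt' : γ ≤ γt := hγle.trans ((min_le_right _ _).trans (min_le_right _ _))
  have hγ1 : γ ≤ 1 := hγt'.trans hγt1
  have hPd : (F.P K).d = 3 := rfl
  have hPL : (F.P K).L = F.L := rfl
  -- thresholds
  set θ : ℕ → ℝ := fun i => θBal F.L γ b₀ p₀ i with hθ
  have hθσ : ∀ i, θ i ≤ σ := fun i => hth F.L F.hL.2.le γ hγ hγt' i
  have hθ0 : ∀ i, 0 ≤ θ i := fun i => (θBal_pos F.hL.2.le hγ hγ1 hb p₀ i).le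
  have hσ1 : σ ≤ 1 := by rw [hσ]; exact (min_le_left _ _).trans (min_le_left _ _)
  have hσ4 : σ ≤ 1 / (4 * (G₀ * C₁ + 1)) := by rw [hσ]; exact (min_le_left _ _).trans (min_le_right _ _)
  have hσN : σ ≤ deltaSU (Fin 2) / (2 * (G₀ * C₁ + G₀ + 1)) := by rw [hσ]; exact (min_le_right _ _).trans (min_le_left _ _)
  have hσδ : σ ≤ δ / (cη * C₁ + 1) := by rw [hσ]; exact (min_le_right _ _).trans (min_le_right _ _)
  -- the BKG tower's sizes and the BKG sup profile
  have hBkg := HB F γ rfl hγ hγB' J K hJK V hV hG U₀ hU₀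
  have hVd : ∀ e, ‖logVec (su2Quat (V e))‖ ≤ 1 / 128 := hGx F J V hG
  have hwt : ∀ t, t < K - J → ∀ b e, wt t b e = if e.dir = b.dir ∧ (b.src b.dir - emb e.src b.dir).val < (F.P K).L then
      ∏ ν ∈ Finset.univ.erase b.dir, max 0 (1 - ((rel (emb e.src) b.src ν).natAbs : ℝ) / (F.P K).L) else 0 := fun t _ b e => hw t b e
  have hVl' : ∀ t, t < K - J → ∀ b, lift t (GaugeField.gaugeAct (g₀ (t + 1)) (Averaging.iter (fun k => blockAvg (P := F.P K) (j := k) ℰp) (t + 1) U₀)) b =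
      expPoint (∑ e, wt t b e • ((((F.P K).L : ℕ) : ℝ)⁻¹ •
        logVec (su2Quat (GaugeField.gaugeAct (g₀ (t + 1)) (Averaging.iter (fun k => blockAvg (P := F.P K) (j := k) ℰp) (t + 1) U₀) e)))) := fun t _ b => hlift t _ b
  obtain ⟨s₂, hs₂0, hs₂b, hs₂4, hs₂1, -⟩ := HS F γ rfl hγ hγs' J K hJK V hVd U₀ hU₀.1 hU₀.2.1 g₀ wt
    (fun t => lift t (GaugeField.gaugeAct (g₀ (t + 1)) (Averaging.iter (fun k => blockAvg (P := F.P K) (j := k) ℰp) (t + 1) U₀))) hwt hVl' h1' h4' h5'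
  -- the per-level sizes
  set θW : ℕ → ℝ := fun j => C₁ * θ J * (F.L : ℝ) ^ (2 * j) * ((F.L : ℝ)⁻¹) ^ (2 * (K - J)) with hθW
  set θU : ℕ → ℝ := fun j => 4 * ((F.L : ℝ)⁻¹ * s₂ (j + 1)) + θW j with hθU
  have hpowle : ∀ j, j ≤ K - J → (F.L : ℝ) ^ (2 * j) * ((F.L : ℝ)⁻¹) ^ (2 * (K - J)) ≤ 1 := by
    intro j hj
    rw [inv_pow, ← div_eq_mul_inv, div_le_one (by positivity)]
    exact pow_le_pow_right₀ hL'.le (by omega)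
  have hθW0 : ∀ j, 0 ≤ θW j := fun j =>
    mul_nonneg (mul_nonneg (mul_nonneg hC₁ (hθ0 J)) (pow_nonneg hL0.le _)) (pow_nonneg (inv_nonneg.2 hL0.le) _)
  have hθpos : ∀ i, 0 < θ i := fun i => θBal_pos F.hL.2.le hγ hγ1 hb p₀ i
  have hwpos : ∀ j, 0 < (F.L : ℝ) ^ (2 * j) * ((F.L : ℝ)⁻¹) ^ (2 * (K - J)) := fun j => by positivity
  have hθWle : ∀ j, j ≤ K - J → θW j ≤ C₁ * σ := fun j hj => by
    simp only [hθW]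
    calc C₁ * θ J * (F.L : ℝ) ^ (2 * j) * ((F.L : ℝ)⁻¹) ^ (2 * (K - J)) ≤ C₁ * θ J * 1 :=
          by rw [mul_assoc (C₁ * θ J)]; exact mul_le_mul_of_nonneg_left (hpowle j hj) (mul_nonneg hC₁ (hθ0 J))
      _ ≤ C₁ * σ := by rw [mul_one]; exact mul_le_mul_of_nonneg_left (hθσ J) hC₁
  have hθU0 : ∀ j, 0 ≤ θU j := fun j =>
    add_nonneg (mul_nonneg (by norm_num) (mul_nonneg (inv_nonneg.2 hL0.le) (hs₂0 _))) (hθW0 j)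
  refine ⟨fun j => cη * θW j, fun j => Rb * G₀ * ((4 * M₅ + 4) * θU j + 8 * M₅ * θW j),
    fun j => mul_nonneg hcη0 (hθW0 j), fun j => by have := hθU0 j; have := hθW0 j; positivity, fun j hj => ?_, ?_, ?_⟩
  rotate_left
  · -- `Σ η ≤ δ`
    have hL2r : (2 : ℝ) ≤ F.L := by exact_mod_cast hL
    have hgeo := geo_weight_sum_le_one hL2r (K - J)
    calc ∑ j ∈ range (K - J), cη * θW j = cη * C₁ * θ J * ∑ j ∈ range (K - J), (F.L : ℝ) ^ (2 * j) * ((F.L : ℝ)⁻¹) ^ (2 * (K - J)) := by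
          rw [Finset.mul_sum]; exact Finset.sum_congr rfl fun j _ => by simp only [hθW]; ring
      _ ≤ δ := eta_budget_le hcη0 hC₁ (hθ0 J) (hθσ J) hσδ hgeo
  · -- `Σ ζ ≤ Z`
    have hL2r : (2 : ℝ) ≤ F.L := by exact_mod_cast hL
    have hsumW : ∑ j ∈ range (K - J), θW j ≤ C₁ := by
      have hg := geo_weight_sum_le_one hL2r (K - J)
      have hθ1 : θ J ≤ 1 := (hθσ J).trans hσ1
      calc ∑ j ∈ range (K - J), θW j = C₁ * θ J * ∑ j ∈ range (K - J), (F.L : ℝ) ^ (2 * j) * ((F.L : ℝ)⁻¹) ^ (2 * (K - J)) := by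
            rw [Finset.mul_sum]; exact Finset.sum_congr rfl fun j _ => by simp only [hθW]; ring
        _ ≤ C₁ * θ J * 1 := mul_le_mul_of_nonneg_left hg (mul_nonneg hC₁ (hθ0 J))
        _ ≤ C₁ * 1 * 1 := mul_le_mul_of_nonneg_right (mul_le_mul_of_nonneg_left hθ1 hC₁) zero_le_one
        _ = C₁ := by ring
    have hsumU : ∑ j ∈ range (K - J), θU j ≤ 4 * (F.L : ℝ)⁻¹ * Es + C₁ := by
      have : ∑ j ∈ range (K - J), θU j = 4 * (F.L : ℝ)⁻¹ * ∑ j ∈ range (K - J), s₂ (j + 1) + ∑ j ∈ range (K - J), θW j := by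
        rw [Finset.mul_sum, ← Finset.sum_add_distrib]; exact Finset.sum_congr rfl fun j _ => by simp only [hθU]; ring
      rw [this]; exact add_le_add (mul_le_mul_of_nonneg_left hs₂1 (by positivity)) hsumW
    calc ∑ j ∈ range (K - J), Rb * G₀ * ((4 * M₅ + 4) * θU j + 8 * M₅ * θW j)
        = Rb * G₀ * ((4 * M₅ + 4) * ∑ j ∈ range (K - J), θU j + 8 * M₅ * ∑ j ∈ range (K - J), θW j) := by
          rw [Finset.mul_sum, Finset.mul_sum, ← Finset.sum_add_distrib, Finset.mul_sum]
      _ ≤ Z := by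
          rw [hZ]
          exact mul_le_mul_of_nonneg_left (add_le_add (mul_le_mul_of_nonneg_left hsumU (by positivity))
            (mul_le_mul_of_nonneg_left hsumW (by positivity))) (by positivity)
  · -- the flap letter at level `j`: C4 at `(W, U; W₀, U₀) := (U′₀_j, V₀_j; U′_j, V_j)`
    have hj' : j + 1 ≤ (F.P K).m + (F.P K).K := by show j + 1 ≤ F.m + K; omega
    -- (T4)∕(T5) of the two towers, the lift's straight average
    have hax : ∀ z : Site (F.P K) j, axialT (GaugeField.gaugeAct (g₀ j) (Averaging.iter (fun k => blockAvg (P := F.P K) (j := k) ℰp) j U₀)) (emb (blockOf z)) z = axialT (lift j (GaugeField.gaugeAct (g₀ (j + 1)) (Averaging.iter (fun k => blockAvg (P := F.P K) (j := k) ℰp) (j + 1) U₀))) (emb (blockOf z)) z := h4' j hj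
    have hax₀ : ∀ z : Site (F.P K) j, axialT (GaugeField.gaugeAct (g j) (Averaging.iter (fun k => blockAvg (P := F.P K) (j := k) ℰp) j U)) (emb (blockOf z)) z = axialT (lift j (GaugeField.gaugeAct (g (j + 1)) (Averaging.iter (fun k => blockAvg (P := F.P K) (j := k) ℰp) (j + 1) U))) (emb (blockOf z)) z := h4 j hj
    have havg : ∀ c : PBond (F.P K) (j + 1), AveragingRT.axialAvg (lift j (GaugeField.gaugeAct (g₀ (j + 1)) (Averaging.iter (fun k => blockAvg (P := F.P K) (j := k) ℰp) (j + 1) U₀))) c = avgFun (expMeanLogSU (n := Fin 2)) (GaugeField.gaugeAct (g₀ j) (Averaging.iter (fun k => blockAvg (P := F.P K) (j := k) ℰp) j U₀)) c := by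
      intro c
      rw [axialAvg_lift hj' (wt j) (hw j) (GaugeField.gaugeAct (g₀ (j + 1)) (Averaging.iter (fun k => blockAvg (P := F.P K) (j := k) ℰp) (j + 1) U₀)) _ (hlift j _)]
      exact (congrFun (h5' j hj) c).symm
    have havg₀ : ∀ c : PBond (F.P K) (j + 1), AveragingRT.axialAvg (lift j (GaugeField.gaugeAct (g (j + 1)) (Averaging.iter (fun k => blockAvg (P := F.P K) (j := k) ℰp) (j + 1) U))) c = avgFun (expMeanLogSU (n := Fin 2)) (GaugeField.gaugeAct (g j) (Averaging.iter (fun k => blockAvg (P := F.P K) (j := k) ℰp) j U)) c := by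
      intro c
      rw [axialAvg_lift hj' (wt j) (hw j) (GaugeField.gaugeAct (g (j + 1)) (Averaging.iter (fun k => blockAvg (P := F.P K) (j := k) ℰp) (j + 1) U)) _ (hlift j _)]
      exact (congrFun (h5 j hj) c).symm
    -- the three sizes
    have hWs : PlaqSmall (θW j) (GaugeField.gaugeAct (g₀ j) (Averaging.iter (fun k => blockAvg (P := F.P K) (j := k) ℰp) j U₀)) := by
      intro p
      rw [T4ReTrLipUnitary.plaqHol_gaugeAct, GaugeGroup.dist1_conj]
      refine (hBkg j hj.le p).trans_lt ?_
      simp only [hθW]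
      have := mul_lt_mul_of_pos_right (mul_lt_mul_of_pos_right hC₁lt (hθpos J)) (hwpos j)
      calc C₁₀ * θBal F.L γ b₀ p₀ J * (F.L : ℝ) ^ (2 * j) * ((F.L : ℝ)⁻¹) ^ (2 * (K - J))
          = C₁₀ * θ J * ((F.L : ℝ) ^ (2 * j) * ((F.L : ℝ)⁻¹) ^ (2 * (K - J))) := by simp only [hθ]; ring
        _ < C₁ * θ J * ((F.L : ℝ) ^ (2 * j) * ((F.L : ℝ)⁻¹) ^ (2 * (K - J))) := this
        _ = C₁ * θ J * (F.L : ℝ) ^ (2 * j) * ((F.L : ℝ)⁻¹) ^ (2 * (K - J)) := by ring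
    have hW₀s : PlaqSmall (θ (K - j)) (GaugeField.gaugeAct (g j) (Averaging.iter (fun k => blockAvg (P := F.P K) (j := k) ℰp) j U)) := by
      intro p
      rw [T4ReTrLipUnitary.plaqHol_gaugeAct, GaugeGroup.dist1_conj]
      exact hUg j (by omega) p
    have hUs : PlaqSmall (θU j) (lift j (GaugeField.gaugeAct (g₀ (j + 1)) (Averaging.iter (fun k => blockAvg (P := F.P K) (j := k) ℰp) (j + 1) U₀))) := by
      intro p
      have harc : ∀ b, dist1 ((lift j (GaugeField.gaugeAct (g₀ (j + 1)) (Averaging.iter (fun k => blockAvg (P := F.P K) (j := k) ℰp) (j + 1) U₀))) b) ≤ (F.L : ℝ)⁻¹ * s₂ (j + 1) := fun b =>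
        (dist1_le_norm_logVec _).trans (arc_lift_le hj' (wt j) (hw j) (GaugeField.gaugeAct (g₀ (j + 1)) (Averaging.iter (fun k => blockAvg (P := F.P K) (j := k) ℰp) (j + 1) U₀)) _ (hlift j _) b
          (fun e _ => hs₂b (j + 1) (by omega) e))
      refine (dist1_plaqHol_le_of_bonds _ p).trans_lt ?_
      have h1 := harc ⟨p.src, p.μ⟩; have h2 := harc ⟨p.src.shift p.μ, p.ν⟩; have h3 := harc ⟨p.src.shift p.ν, p.μ⟩; have h4 := harc ⟨p.src, p.ν⟩
      have h5 : 0 < θW j := mul_pos (mul_pos (mul_pos (by linarith) (hθpos J)) (by positivity)) (by positivity)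
      simp only [hθU]; linarith
    -- the guards of C4 on the background's sizes
    have hθW4 : ((((F.P K).d + 2) * (F.P K).L : ℕ) : ℝ) ^ 2 / 4 * θW j ≤ 1 / 4 := by
      rw [hPd, hPL, ← hG₀]; exact guard_quarter hG₀0 hC₁ (hθWle j hj.le) hσ4
    have hθWN : ((((F.P K).d + 2) * (F.P K).L : ℕ) : ℝ) ^ 2 / 4 * θW j < deltaSU (Fin 2) := by
      rw [hPd, hPL, ← hG₀]; exact guard_lt hG₀0 hC₁ hδSU (hθWle j hj.le) hσN
    have hθW₀N : ((((F.P K).d + 2) * (F.P K).L : ℕ) : ℝ) ^ 2 / 4 * θ (K - j) < deltaSU (Fin 2) := by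
      rw [hPd, hPL, ← hG₀]; exact guard_lt' hG₀0 hC₁ hδSU (hθσ _) hσN
    -- C4
    have h := sqrt_sum_dist1_flap_rel_sq_le' hj' (GaugeField.gaugeAct (g₀ j) (Averaging.iter (fun k => blockAvg (P := F.P K) (j := k) ℰp) j U₀)) (lift j (GaugeField.gaugeAct (g₀ (j + 1)) (Averaging.iter (fun k => blockAvg (P := F.P K) (j := k) ℰp) (j + 1) U₀))) (GaugeField.gaugeAct (g j) (Averaging.iter (fun k => blockAvg (P := F.P K) (j := k) ℰp) j U)) (lift j (GaugeField.gaugeAct (g (j + 1)) (Averaging.iter (fun k => blockAvg (P := F.P K) (j := k) ℰp) (j + 1) U))) hax hax₀ havg havg₀ (hθW0 j) (hθU0 j) (hθ0 (K - j))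
      hWs hUs hW₀s hθW4 hθWN hθW₀N
    rw [hPd, hPL] at h
    rw [← hG₀, ← hM₅, ← hRa, ← hRb, ← hRc, ← hRd, ← hLd] at h
    -- currencies: right-relative (door) versus left-relative (C4)
    have eA : ∑ q : Plaq (F.P K) j, dist1 ((GaugeField.plaqHol (GaugeField.gaugeAct (g j) (Averaging.iter (fun k => blockAvg (P := F.P K) (j := k) ℰp) j U)) q)⁻¹ * GaugeField.plaqHol (GaugeField.gaugeAct (g₀ j) (Averaging.iter (fun k => blockAvg (P := F.P K) (j := k) ℰp) j U₀)) q) ^ 2 =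
        ∑ q, dist1 ((GaugeField.plaqHol (GaugeField.gaugeAct (g₀ j) (Averaging.iter (fun k => blockAvg (P := F.P K) (j := k) ℰp) j U₀)) q)⁻¹ * GaugeField.plaqHol (GaugeField.gaugeAct (g j) (Averaging.iter (fun k => blockAvg (P := F.P K) (j := k) ℰp) j U)) q) ^ 2 :=
      Finset.sum_congr rfl fun q _ => by rw [dist1_inv_mul_comm', ← dist1_inv_mul_eq]
    have eAv : ∑ q : Plaq (F.P K) j, dist1 ((GaugeField.plaqHol (lift j (GaugeField.gaugeAct (g (j + 1)) (Averaging.iter (fun k => blockAvg (P := F.P K) (j := k) ℰp) (j + 1) U))) q)⁻¹ * GaugeField.plaqHol (lift j (GaugeField.gaugeAct (g₀ (j + 1)) (Averaging.iter (fun k => blockAvg (P := F.P K) (j := k) ℰp) (j + 1) U₀))) q) ^ 2 =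
        ∑ q, dist1 ((GaugeField.plaqHol (lift j (GaugeField.gaugeAct (g₀ (j + 1)) (Averaging.iter (fun k => blockAvg (P := F.P K) (j := k) ℰp) (j + 1) U₀))) q)⁻¹ * GaugeField.plaqHol (lift j (GaugeField.gaugeAct (g (j + 1)) (Averaging.iter (fun k => blockAvg (P := F.P K) (j := k) ℰp) (j + 1) U))) q) ^ 2 :=
      Finset.sum_congr rfl fun q _ => by rw [dist1_inv_mul_comm', ← dist1_inv_mul_eq]
    have eB : ∑ b : PBond (F.P K) j, dist1 (T4TiltOscillation.bdev (GaugeField.gaugeAct (g₀ j) (Averaging.iter (fun k => blockAvg (P := F.P K) (j := k) ℰp) j U₀)) (GaugeField.gaugeAct (g j) (Averaging.iter (fun k => blockAvg (P := F.P K) (j := k) ℰp) j U)) b) ^ 2 =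
        ∑ b, dist1 ((GaugeField.gaugeAct (g j) (Averaging.iter (fun k => blockAvg (P := F.P K) (j := k) ℰp) j U)) b * ((GaugeField.gaugeAct (g₀ j) (Averaging.iter (fun k => blockAvg (P := F.P K) (j := k) ℰp) j U₀)) b)⁻¹) ^ 2 :=
      Finset.sum_congr rfl fun b _ => by rw [T4TiltOscillation.bdev, dist1_inv_mul_eq]
    have eBv : ∑ b : PBond (F.P K) j, dist1 (T4TiltOscillation.bdev (lift j (GaugeField.gaugeAct (g₀ (j + 1)) (Averaging.iter (fun k => blockAvg (P := F.P K) (j := k) ℰp) (j + 1) U₀))) (lift j (GaugeField.gaugeAct (g (j + 1)) (Averaging.iter (fun k => blockAvg (P := F.P K) (j := k) ℰp) (j + 1) U))) b) ^ 2 =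
        ∑ b, dist1 ((lift j (GaugeField.gaugeAct (g (j + 1)) (Averaging.iter (fun k => blockAvg (P := F.P K) (j := k) ℰp) (j + 1) U))) b * ((lift j (GaugeField.gaugeAct (g₀ (j + 1)) (Averaging.iter (fun k => blockAvg (P := F.P K) (j := k) ℰp) (j + 1) U₀))) b)⁻¹) ^ 2 :=
      Finset.sum_congr rfl fun b _ => by rw [T4TiltOscillation.bdev, dist1_inv_mul_eq]
    rw [eA, eAv, eB, eBv] at h
    rw [hcη]
    exact h.trans (le_of_eq (by ring))

end Summit.QuantumFields.YangMills.Theorems.FluctuationComparisonRegPrIntLS2BetaStageFlapLetterOfC4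

end
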